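import Mathlib
import Summits.NavierStokesRegularity.NavierStokesRegularity.Theorems.TaoLadderRungTwoBreakBlowupRigidityOneSmallData
import HarnessLib

/-!
# The small-datum / large-viscosity corner of the KP shell barrier: below the dissipation threshold EVERY table obeys
# EVERY weighted shell barrier (helper file for the crux `SubOnsagerCeiling.ForwardTailCeilingKP`,
# stmt-NavierStokesRegularity-27057, `--supports`; hand leafhand-ns-subonsagerceiling-4 gen 25; def-free)

Companion of `Theorems/SubOnsagerCeilingKPUnitViscosity.lean` (this hand, p843933): there the registered currencies of the
crux (`θ, C/D` chosen BEFORE `∀ ν > 0`) were shown to be LARGE-DATA statements at unit viscosity (the lattice only sees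
`X₀/ν`).  This file records the complementary corner, by name, from the tree's sign-free small-data machinery for Tao's
damped lattice (`BlowupRigidityOne.envelope_persists`, route TaoLadderRungTwoBreak, K2(1)): for EVERY table whose structure
constants have modulus `≤ 1` on Tao's shift set (in particular every `α ∈ E₂(R)`; NO sign / orthant / diagonal-feed
condition), every scale ratio `1+ε₀ > 1`, every viscosity `ν > 0` and every honest solution on `[0,s]` from a one-shell
datum `X₀` with

  `512 · (1+ε₀)^16 · √(2E₀) < ν`,  `E₀ = Σ_j ½ X₀_j²`,

the geometric envelope `|X_{i,k}(t)| ≤ 2√(2E₀) · (1+ε₀)^{-9k}` persists (`smallDatum_envelope`), hence the weighted shell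
barrier `(1+ε₀)^{2θk} · ½X_{i,k}(t)² ≤ 4E₀` holds for EVERY exponent `θ ≤ 9` — in particular for the whole range
`θ ∈ (1/2, 1]` of the registered stubs `stub_primaryGradedLargeRatio` / `stub_primaryGradedSmallRatio` — with `D = 4`
(`smallDatum_shellBarrier`; `smallDatum_shellBarrier_of_inTableClass` in the vocabulary `InTableClass R α` of the stubs).

* `restrictShiftSet_abs_le`, `quadTerm_restrictShiftSet` — the cascade nonlinearity only reads the table on the shift set,
  so a table bounded by `1` there may be replaced by its restriction (bounded by `1` everywhere), which is what the tree's
  envelope lemma wants;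
* `smallDatum_envelope` — the persistent envelope (corollary of `BlowupRigidityOne.envelope_persists`, `m = 4`, `M_α = 1`);
* **`smallDatum_shellBarrier`**, `smallDatum_shellBarrier_of_inTableClass` — the barrier corner.

READING (repair census of item 27057).  Together with p843933: the `ν`-uniform sub-Onsager barrier of the stubs is, at unit
viscosity, a statement about ALL one-shell data, and it HOLDS (for every `θ ≤ 9`, every table, sign-free) for data below the
dissipation threshold `√(2E₀) < 2⁻⁹(1+ε₀)^{-16}`; equivalently, for a fixed datum it holds for all viscosities
`ν > 512(1+ε₀)^{16}√(2E₀)`.  The open content of both stubs is therefore EXACTLY the large-data (small-viscosity) extension,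
where the cascade front forms — nothing else.  HONEST FRAMING: a small-data corner of statements about Tao-type MODEL lattice
ODEs (route SubOnsagerCeiling, rung TL-M2Break); no stub, crux or summit is proved here and nothing in this file bears on
Navier–Stokes regularity.
[cite: Tao2016AveragedNS, §4 Lemma 4.1 (4.5), (4.8), (4.11), (4.13)] [cite: BarbatoMorandinRomito2011, §3.1 Prop. 3.3 (invariant region / small data)]
-/

noncomputable section

-- the summit and its single sub-problem share the name (CONVENTIONS §1)
set_option linter.dupNamespace false

open Set

namespace Summit.NavierStokesRegularity.NavierStokesRegularity.Theorems.SubOnsagerCeiling.SmallDatum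

open Literature.Analysis.FluidPDE Literature.Analysis.FluidPDE.TaoCascade
open Summit.NavierStokesRegularity.NavierStokesRegularity.Theorems.BlowupRigidityOne

variable {m : ℕ}

/-! ## The nonlinearity only reads the table on the shift set -/

/-- A table bounded by `1` on the shift set has a restriction (zero off the shift set) bounded by `1` everywhere.
[cite: Tao2016AveragedNS, §4 (4.1)–(4.2) (only the values on `S` are used)] -/
theorem restrictShiftSet_abs_le {α : Fin m → Fin m → Fin m → ℤ × ℤ × ℤ → ℝ}
    (hα : ∀ (i₁ i₂ i₃ : Fin m) (μ : ℤ × ℤ × ℤ), μ ∈ shiftSet → |α i₁ i₂ i₃ μ| ≤ 1) :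
    ∀ (i₁ i₂ i₃ : Fin m) (μ : ℤ × ℤ × ℤ),
      |(fun j₁ j₂ j₃ μ' => if μ' ∈ shiftSet then α j₁ j₂ j₃ μ' else 0) i₁ i₂ i₃ μ| ≤ 1 := by
  intro i₁ i₂ i₃ μ
  by_cases hμ : μ ∈ shiftSet
  · simp only [hμ, if_true]; exact hα i₁ i₂ i₃ μ hμ
  · simp [hμ]

/-- The cascade nonlinearity of the restricted table is that of the table. [cite: Tao2016AveragedNS, §4 (4.8)] -/
theorem quadTerm_restrictShiftSet (ε₀ : ℝ) (α : Fin m → Fin m → Fin m → ℤ × ℤ × ℤ → ℝ)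
    (X : Fin m → ℤ → ℝ → ℝ) (i : Fin m) (n : ℤ) (t : ℝ) :
    quadTerm ε₀ (fun j₁ j₂ j₃ μ' => if μ' ∈ shiftSet then α j₁ j₂ j₃ μ' else 0) X i n t =
      quadTerm ε₀ α X i n t := by
  unfold quadTerm
  refine Finset.sum_congr rfl fun i₁ _ => Finset.sum_congr rfl fun i₂ _ => Finset.sum_congr rfl fun μ hμ => ?_
  simp only [hμ, if_true]

/-! ## The persistent envelope below the dissipation threshold (four modes, `|α| ≤ 1` on the shift set) -/

/-- **SMALL-DATUM ENVELOPE.** Let `ε₀ > 0`, `0 < δ`, `128 (1+ε₀)^{16} δ < ν`, and let the four-mode table `α` have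
modulus `≤ 1` on the shift set (no sign condition).  Every honest solution of the `ν`-viscous lattice on `[0,s]` from a
one-shell datum with `|X₀ᵢ| ≤ δ/2` (no shells below `0`, Tao's weight bound (4.5), continuous, one-sided derivatives
within `[0,s]`) obeys `|X_{i,k}(t)| ≤ δ (1+ε₀)^{-9k}` for all `t ∈ [0,s]`, all modes and ALL shells `k ∈ ℤ`.
(The tree's `BlowupRigidityOne.envelope_persists` with `m = 4`, `M_α = 1`, applied to the restricted table.)
[cite: Tao2016AveragedNS, §4 Lemma 4.1 (4.5), (4.8), (4.11)] [cite: BarbatoMorandinRomito2011, §3.1 Prop. 3.3] -/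
theorem smallDatum_envelope {ε₀ ν δ s : ℝ} (hε : 0 < ε₀) (hδ : 0 < δ)
    {α : Fin 4 → Fin 4 → Fin 4 → ℤ × ℤ × ℤ → ℝ}
    (hα : ∀ (i₁ i₂ i₃ : Fin 4) (μ : ℤ × ℤ × ℤ), μ ∈ shiftSet → |α i₁ i₂ i₃ μ| ≤ 1)
    (hsmall : 128 * (1 + ε₀) ^ (16 : ℝ) * δ < ν)
    {X₀ : Fin 4 → ℝ} (hX₀ : ∀ i, |X₀ i| ≤ δ / 2)
    {X : Fin 4 → ℤ → ℝ → ℝ} (hs : 0 ≤ s)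
    (hX0 : ∀ (i : Fin 4) (k : ℤ), X i k 0 = if k = 0 then X₀ i else 0)
    (hXneg : ∀ (i : Fin 4) (k : ℤ), k < 0 → ∀ t : ℝ, X i k t = 0)
    (hM : ∃ M : ℝ, ∀ (t : ℝ) (i : Fin 4) (k : ℤ), (1 + (1 + ε₀) ^ ((10 : ℝ) * k)) * |X i k t| ≤ M)
    (hXc : ∀ (i : Fin 4) (k : ℤ), Continuous (X i k))
    (hXd : ∀ (i : Fin 4) (k : ℤ), ∀ t ∈ Icc (0 : ℝ) s, HasDerivWithinAt (X i k)
      (quadTerm ε₀ α X i k t - ν * (1 + ε₀) ^ ((2 : ℝ) * k) * X i k t) (Icc (0 : ℝ) s) t) :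
    ∀ (i : Fin 4) (k : ℤ), ∀ t ∈ Icc (0 : ℝ) s, |X i k t| ≤ δ * (1 + ε₀) ^ (-((9 : ℝ) * k)) := by
  set α' : Fin 4 → Fin 4 → Fin 4 → ℤ × ℤ × ℤ → ℝ :=
    fun j₁ j₂ j₃ μ' => if μ' ∈ shiftSet then α j₁ j₂ j₃ μ' else 0 with hα'
  have hα1 : ∀ (i₁ i₂ i₃ : Fin 4) (μ : ℤ × ℤ × ℤ), |α' i₁ i₂ i₃ μ| ≤ 1 := restrictShiftSet_abs_le hα
  have hsmall' : 8 * ((4 : ℕ) : ℝ) ^ 2 * 1 * (1 + ε₀) ^ (16 : ℝ) * δ < ν := by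
    have : 8 * ((4 : ℕ) : ℝ) ^ 2 * 1 * (1 + ε₀) ^ (16 : ℝ) * δ = 128 * (1 + ε₀) ^ (16 : ℝ) * δ := by
      push_cast; ring
    rw [this]; exact hsmall
  have hXd' : ∀ (i : Fin 4) (k : ℤ), ∀ t ∈ Icc (0 : ℝ) s, HasDerivWithinAt (X i k)
      (quadTerm ε₀ α' X i k t - ν * (1 + ε₀) ^ ((2 : ℝ) * k) * X i k t) (Icc (0 : ℝ) s) t := by
    intro i k t ht
    rw [hα', quadTerm_restrictShiftSet]
    exact hXd i k t ht
  exact envelope_persists (m := 4) hε hδ hα1 hsmall' hX₀ hs hX0 hXneg hM hXc hXd'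

/-! ## The shell barrier below the dissipation threshold -/

/-- One component of a one-shell datum is bounded by the root of twice its energy: `|X₀ᵢ| ≤ √(2E₀)`. [folklore] -/
theorem abs_le_sqrt_two_mul_energy (X₀ : Fin 4 → ℝ) (i : Fin 4) :
    |X₀ i| ≤ Real.sqrt (2 * ∑ j : Fin 4, (1 / 2 : ℝ) * X₀ j ^ 2) := by
  have hle : X₀ i ^ 2 ≤ 2 * ∑ j : Fin 4, (1 / 2 : ℝ) * X₀ j ^ 2 := by
    have h1 : (1 / 2 : ℝ) * X₀ i ^ 2 ≤ ∑ j : Fin 4, (1 / 2 : ℝ) * X₀ j ^ 2 :=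
      Finset.single_le_sum (f := fun j => (1 / 2 : ℝ) * X₀ j ^ 2) (fun j _ => by positivity) (Finset.mem_univ i)
    linarith
  calc |X₀ i| = Real.sqrt (X₀ i ^ 2) := (Real.sqrt_sq_eq_abs (X₀ i)).symm
    _ ≤ Real.sqrt (2 * ∑ j : Fin 4, (1 / 2 : ℝ) * X₀ j ^ 2) := Real.sqrt_le_sqrt hle

/-- **SMALL-DATUM SHELL BARRIER (every table, every exponent `θ ≤ 9`, sign-free).** Let `ε₀ > 0`, `ν > 0`, `θ ≤ 9`, let
the four-mode table `α` have modulus `≤ 1` on the shift set, and let `X` be an honest solution of the `ν`-viscous lattice on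
`[0,s]` from the one-shell datum `X₀` (no shells below `0`, weight bound (4.5), continuous, one-sided derivatives within
`[0,s]`).  If the datum is below the dissipation threshold, `512 (1+ε₀)^{16} √(2E₀) < ν` with `E₀ = Σ_j ½X₀_j²`, then
`(1+ε₀)^{2θk} · ½X_{i,k}(t)² ≤ 4 E₀` for all `t ∈ [0,s]`, all modes `i` and all shells `k ≥ 0` — the weighted shell
barrier of the registered stubs with `D = 4`, in its small-datum (= large-viscosity) corner.
[cite: Tao2016AveragedNS, §4 Lemma 4.1 (4.5), (4.8), (4.11), (4.13)] [cite: BarbatoMorandinRomito2011, §3.1 Prop. 3.3] -/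
theorem smallDatum_shellBarrier {ε₀ ν θ s : ℝ} (hε : 0 < ε₀) (hν : 0 < ν) (hθ : θ ≤ 9)
    {α : Fin 4 → Fin 4 → Fin 4 → ℤ × ℤ × ℤ → ℝ}
    (hα : ∀ (i₁ i₂ i₃ : Fin 4) (μ : ℤ × ℤ × ℤ), μ ∈ shiftSet → |α i₁ i₂ i₃ μ| ≤ 1)
    {X₀ : Fin 4 → ℝ}
    (hsmall : 512 * (1 + ε₀) ^ (16 : ℝ) * Real.sqrt (2 * ∑ j : Fin 4, (1 / 2 : ℝ) * X₀ j ^ 2) < ν)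
    {X : Fin 4 → ℤ → ℝ → ℝ} (hs : 0 ≤ s)
    (hX0 : ∀ (i : Fin 4) (k : ℤ), X i k 0 = if k = 0 then X₀ i else 0)
    (hXneg : ∀ (i : Fin 4) (k : ℤ), k < 0 → ∀ t : ℝ, X i k t = 0)
    (hM : ∃ M : ℝ, ∀ (t : ℝ) (i : Fin 4) (k : ℤ), (1 + (1 + ε₀) ^ ((10 : ℝ) * k)) * |X i k t| ≤ M)
    (hXc : ∀ (i : Fin 4) (k : ℤ), Continuous (X i k))
    (hXd : ∀ (i : Fin 4) (k : ℤ), ∀ t ∈ Icc (0 : ℝ) s, HasDerivWithinAt (X i k)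
      (quadTerm ε₀ α X i k t - ν * (1 + ε₀) ^ ((2 : ℝ) * k) * X i k t) (Icc (0 : ℝ) s) t) :
    ∀ t ∈ Icc (0 : ℝ) s, ∀ (i : Fin 4) (k : ℕ),
      (1 + ε₀) ^ (2 * θ * (k : ℝ)) * ((1 / 2 : ℝ) * X i (k : ℤ) t ^ 2) ≤
        4 * (∑ j : Fin 4, (1 / 2 : ℝ) * X₀ j ^ 2) := by
  intro t ht i k
  have hb : 0 < 1 + ε₀ := by linarith
  have hb1 : 1 ≤ 1 + ε₀ := by linarith
  set E₀ : ℝ := ∑ j : Fin 4, (1 / 2 : ℝ) * X₀ j ^ 2 with hE₀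
  have hE₀0 : 0 ≤ E₀ := Finset.sum_nonneg fun j _ => by positivity
  set ρ : ℝ := Real.sqrt (2 * E₀) with hρ
  have hρ0 : 0 ≤ ρ := Real.sqrt_nonneg _
  have hρsq : ρ ^ 2 = 2 * E₀ := Real.sq_sqrt (by positivity)
  have hX₀ρ : ∀ j, |X₀ j| ≤ ρ := fun j => abs_le_sqrt_two_mul_energy X₀ j
  have hp16 : 0 < (1 + ε₀) ^ (16 : ℝ) := Real.rpow_pos_of_pos hb _
  -- the envelope `|X_{i,k}(t)| ≤ δ (1+ε₀)^{-9k}` for every `δ > 2ρ` with `128 (1+ε₀)^{16} δ < ν`, hence for `δ ↓ 2ρ`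
  have henv : ∀ δ : ℝ, 2 * ρ < δ → 128 * (1 + ε₀) ^ (16 : ℝ) * δ < ν →
      |X i (k : ℤ) t| ≤ δ * (1 + ε₀) ^ (-((9 : ℝ) * ((k : ℤ) : ℝ))) := by
    intro δ hδρ hδν
    have hδ : 0 < δ := by linarith
    exact smallDatum_envelope hε hδ hα hδν (fun j => by linarith [hX₀ρ j]) hs hX0 hXneg hM hXc hXd i k t ht
  -- pass to the limit `δ ↓ 2ρ`
  have hw9 : 0 < (1 + ε₀) ^ (-((9 : ℝ) * ((k : ℤ) : ℝ))) := Real.rpow_pos_of_pos hb _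
  have hlim : |X i (k : ℤ) t| ≤ 2 * ρ * (1 + ε₀) ^ (-((9 : ℝ) * ((k : ℤ) : ℝ))) := by
    by_contra hcon
    push Not at hcon
    -- room: `256 (1+ε₀)^{16} ρ < ν/2`, so some `δ ∈ (2ρ, ·)` is admissible and still violated
    set gap : ℝ := |X i (k : ℤ) t| / (1 + ε₀) ^ (-((9 : ℝ) * ((k : ℤ) : ℝ))) - 2 * ρ with hgap
    have hgap0 : 0 < gap := by
      rw [hgap, sub_pos, lt_div_iff₀ hw9]; exact hcon
    set room : ℝ := (ν / (128 * (1 + ε₀) ^ (16 : ℝ)) - 2 * ρ) with hroom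
    have hroom0 : 0 < room := by
      rw [hroom, sub_pos, lt_div_iff₀ (by positivity)]
      have : 512 * (1 + ε₀) ^ (16 : ℝ) * ρ < ν := hsmall
      nlinarith [hp16, hρ0]
    set δ : ℝ := 2 * ρ + min gap room / 2 with hδdef
    have hmin0 : 0 < min gap room := lt_min hgap0 hroom0
    have hδρ : 2 * ρ < δ := by rw [hδdef]; linarith
    have hδν : 128 * (1 + ε₀) ^ (16 : ℝ) * δ < ν := by
      have h1 : δ < ν / (128 * (1 + ε₀) ^ (16 : ℝ)) := by
        have : min gap room ≤ room := min_le_right _ _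
        rw [hδdef]; rw [hroom] at this; linarith
      have := (lt_div_iff₀ (by positivity : (0 : ℝ) < 128 * (1 + ε₀) ^ (16 : ℝ))).1 h1
      linarith
    have hX := henv δ hδρ hδν
    have h2 : δ < |X i (k : ℤ) t| / (1 + ε₀) ^ (-((9 : ℝ) * ((k : ℤ) : ℝ))) := by
      have : min gap room ≤ gap := min_le_left _ _
      rw [hδdef]; rw [hgap] at this; linarith
    have h3 := (lt_div_iff₀ hw9).1 h2
    linarith
  -- square and compare the weights: `(1+ε₀)^{2θk} (1+ε₀)^{-18k} ≤ 1` for `θ ≤ 9`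
  have hkr : (((k : ℤ) : ℝ)) = (k : ℝ) := by push_cast; ring
  rw [hkr] at hlim
  have habs0 : 0 ≤ 2 * ρ * (1 + ε₀) ^ (-((9 : ℝ) * (k : ℝ))) := by positivity
  have hsq : X i (k : ℤ) t ^ 2 ≤ (2 * ρ * (1 + ε₀) ^ (-((9 : ℝ) * (k : ℝ)))) ^ 2 := by
    calc X i (k : ℤ) t ^ 2 = |X i (k : ℤ) t| ^ 2 := (sq_abs _).symm
      _ ≤ (2 * ρ * (1 + ε₀) ^ (-((9 : ℝ) * (k : ℝ)))) ^ 2 := pow_le_pow_left₀ (abs_nonneg _) hlim 2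
  have hwt : (1 + ε₀) ^ (2 * θ * (k : ℝ)) * ((1 + ε₀) ^ (-((9 : ℝ) * (k : ℝ)))) ^ 2 ≤ 1 := by
    rw [← Real.rpow_natCast ((1 + ε₀) ^ (-((9 : ℝ) * (k : ℝ)))) 2, ← Real.rpow_mul hb.le,
      ← Real.rpow_add hb]
    have hk0 : (0 : ℝ) ≤ (k : ℝ) := Nat.cast_nonneg k
    have hexp : 2 * θ * (k : ℝ) + -((9 : ℝ) * (k : ℝ)) * ((2 : ℕ) : ℝ) ≤ 0 := by
      push_cast; nlinarith
    exact Real.rpow_le_one_of_one_le_of_nonpos hb1 hexp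
  have hw2 : 0 ≤ (1 + ε₀) ^ (2 * θ * (k : ℝ)) := Real.rpow_nonneg hb.le _
  calc (1 + ε₀) ^ (2 * θ * (k : ℝ)) * ((1 / 2 : ℝ) * X i (k : ℤ) t ^ 2)
      ≤ (1 + ε₀) ^ (2 * θ * (k : ℝ)) * ((1 / 2 : ℝ) * (2 * ρ * (1 + ε₀) ^ (-((9 : ℝ) * (k : ℝ)))) ^ 2) :=
        mul_le_mul_of_nonneg_left (mul_le_mul_of_nonneg_left hsq (by norm_num)) hw2
    _ = 2 * ρ ^ 2 * ((1 + ε₀) ^ (2 * θ * (k : ℝ)) * ((1 + ε₀) ^ (-((9 : ℝ) * (k : ℝ)))) ^ 2) := by ring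
    _ ≤ 2 * ρ ^ 2 * 1 := mul_le_mul_of_nonneg_left hwt (by positivity)
    _ = 4 * E₀ := by rw [hρsq]; ring

/-- The same corner in the vocabulary of the registered stubs: a table of Tao's class `E₂(R)` (`InTableClass R α`:
symmetric, cancelling, `R`-comparable — comparability gives modulus `≤ 1` on the shift set) obeys, below the dissipation
threshold `512(1+ε₀)^{16}√(2E₀) < ν`, the weighted shell barrier `(1+ε₀)^{2θk}·½X_{i,k}(t)² ≤ 4E₀` for every `θ ≤ 9`
(so for the whole stub range `θ ∈ (1/2, 1]`), along every honest solution — signs, orthant and diagonal-feed clauses unused.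
[cite: Tao2016AveragedNS, §4 (4.2)–(4.3), Lemma 4.1 (4.5), (4.13); §6.1 (comparable tables)] -/
theorem smallDatum_shellBarrier_of_inTableClass {R ε₀ ν θ s : ℝ} (hε : 0 < ε₀) (hν : 0 < ν) (hθ : θ ≤ 9)
    {α : Fin 4 → Fin 4 → Fin 4 → ℤ × ℤ × ℤ → ℝ} (hT : InTableClass R α)
    {X₀ : Fin 4 → ℝ}
    (hsmall : 512 * (1 + ε₀) ^ (16 : ℝ) * Real.sqrt (2 * ∑ j : Fin 4, (1 / 2 : ℝ) * X₀ j ^ 2) < ν)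
    {X : Fin 4 → ℤ → ℝ → ℝ} (hs : 0 ≤ s)
    (hX0 : ∀ (i : Fin 4) (k : ℤ), X i k 0 = if k = 0 then X₀ i else 0)
    (hXneg : ∀ (i : Fin 4) (k : ℤ), k < 0 → ∀ t : ℝ, X i k t = 0)
    (hM : ∃ M : ℝ, ∀ (t : ℝ) (i : Fin 4) (k : ℤ), (1 + (1 + ε₀) ^ ((10 : ℝ) * k)) * |X i k t| ≤ M)
    (hXc : ∀ (i : Fin 4) (k : ℤ), Continuous (X i k))
    (hXd : ∀ (i : Fin 4) (k : ℤ), ∀ t ∈ Icc (0 : ℝ) s, HasDerivWithinAt (X i k)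
      (quadTerm ε₀ α X i k t - ν * (1 + ε₀) ^ ((2 : ℝ) * k) * X i k t) (Icc (0 : ℝ) s) t) :
    ∀ t ∈ Icc (0 : ℝ) s, ∀ (i : Fin 4) (k : ℕ),
      (1 + ε₀) ^ (2 * θ * (k : ℝ)) * ((1 / 2 : ℝ) * X i (k : ℤ) t ^ 2) ≤
        4 * (∑ j : Fin 4, (1 / 2 : ℝ) * X₀ j ^ 2) :=
  smallDatum_shellBarrier hε hν hθ (fun i₁ i₂ i₃ μ hμ => (hT.2.2 i₁ i₂ i₃ μ hμ).1) hsmall hs hX0 hXneg hM hXc hXd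

end Summit.NavierStokesRegularity.NavierStokesRegularity.Theorems.SubOnsagerCeiling.SmallDatum

end
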